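import Summits.Parity.GeneralizedHardyLittlewood.Theorems.PrimeLevelFamEdgeMomentsBeyondDiagonalDiagRemDeformedIdentity
import HarnessLib

/-!
# Route `PrimeLevelFamEdge`, crux K_A `MomentsBeyondDiagonal` (stmt-Parity-20007), line «petersson_layers» v4, stub `stub_diag`:
# **pointwise bounds for the `t`-deformed local factors `η_n^{(c)}(m) = c!·[X^c]H_n(m)`** (brick D4a of «D4TAIL»)

`H_n = AE ∗ AE⁻ ∗ 𝔄_n` (`…DiagRemDeformedIdentity`) is a multiplicative `ℝ⟦X⟧`-valued arithmetic function; its `X`-coefficients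
`η_n^{(c)}(m)/c!` are the `t`-deformed local factors of «D4TAIL». This file and its sequel prove the pointwise bounds that feed the weighted `ℓ¹`
estimate (`…DiagRemDeformedLocalSum`, pattern of `…KernelFormXSqLocalSum` for `h_n = η_n^{(0)}`):

* `isMultiplicative_AE`, `isMultiplicative_frakA`, `isMultiplicative_H` — multiplicativity (hypothesis-parametrised, def-free);
* `abs_eta_le_crude` — **`|η_n^{(c)}(m)| ≤ τ(m)³(log m)^c/m`** for all `m ≥ 1` (no cancellation used);
(the squarefree bound `|η_n^{(c)}(u)| ≤ τ(u)gcd(n,u)(log u)^c/u²` — where the cancellation `1/p + W(p) = 1/(p(p+1))` enters — and the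
Leibniz splitting over coprime factorisations are in the sequel `…DiagRemDeformedLocalSqf`).

Def-free; theorems only. Helper `--supports stmt-Parity-20007`; closes nothing; K_A, K_B and the Parity summit are NOT proved;
nothing about Landau–Siegel zeros.

## References
* E. Kowalski, P. Michel, J. VanderKam, J. reine angew. Math. 526 (2000), Prop. 5.1 p. 18.
  [cite: KowalskiMichelVanderKam2000, Prop. 5.1 — derivation (local factors of ν(s), absolute convergence)]
-/

noncomputable section

open Finset Real ArithmeticFunction

namespace Summit.Parity.GeneralizedHardyLittlewood.Theorems.MomentsBeyondDiagonal.DiagCorner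

open Literature.NumberTheory.LFunctions.KMV2000.MollifierMainTerm (W G invA)
open Summit.Parity.GeneralizedHardyLittlewood.Theorems.BeyondDiagonalBeatsQuarter.KernelFormXSq
  (copTauW copTauW_apply invA_apply' isMultiplicative_W' isMultiplicative_invA' abs_W_le)

/-! ### Multiplicativity -/

/-- `AE = id⁻¹·e^{sX log}` is multiplicative. [folklore] -/
theorem isMultiplicative_AE (s : ℝ) (AE : ArithmeticFunction (PowerSeries ℝ))
    (hAE : ∀ d : ℕ, AE d = PowerSeries.C ((d : ℝ)⁻¹) * PowerSeries.rescale (s * Real.log d) (PowerSeries.exp ℝ)) :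
    AE.IsMultiplicative := by
  refine ⟨?_, fun {m n} _ ↦ ?_⟩
  · rw [hAE]; simp
  · rcases Nat.eq_zero_or_pos m with rfl | hm
    · simp [hAE]
    rcases Nat.eq_zero_or_pos n with rfl | hn
    · simp [hAE]
    rw [hAE, hAE m, hAE n, show PowerSeries.C ((m : ℝ)⁻¹) * PowerSeries.rescale (s * Real.log m) (PowerSeries.exp ℝ) *
        (PowerSeries.C ((n : ℝ)⁻¹) * PowerSeries.rescale (s * Real.log n) (PowerSeries.exp ℝ)) =
        PowerSeries.C ((m : ℝ)⁻¹ * (n : ℝ)⁻¹) * (PowerSeries.rescale (s * Real.log m) (PowerSeries.exp ℝ) *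
          PowerSeries.rescale (s * Real.log n) (PowerSeries.exp ℝ)) by rw [map_mul]; ring,
      expWeight_mul_eq_of_mul (by omega) (by omega)]
    push_cast
    rw [mul_inv]

/-- `W_n = 1_{(·,n)=1}·W` (as `C ∘ W_n`) is multiplicative. [folklore] -/
theorem isMultiplicative_Wc (n : ℕ) (Wc : ArithmeticFunction (PowerSeries ℝ))
    (hWc : ∀ k : ℕ, Wc k = PowerSeries.C (if k.Coprime n then W k else 0)) : Wc.IsMultiplicative := by
  refine ⟨?_, fun {a b} hab ↦ ?_⟩
  · rw [hWc, if_pos (Nat.coprime_one_left n), isMultiplicative_W'.map_one, map_one]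
  · rw [hWc, hWc a, hWc b, ← map_mul]
    congr 1
    by_cases ha : a.Coprime n
    · by_cases hb : b.Coprime n
      · rw [if_pos (Nat.Coprime.mul_left ha hb), if_pos ha, if_pos hb, isMultiplicative_W'.map_mul_of_coprime hab]
      · have : ¬ (a * b).Coprime n := fun h ↦ hb (Nat.Coprime.coprime_mul_left h)
        rw [if_neg this, if_neg hb, mul_zero]
    · have : ¬ (a * b).Coprime n := fun h ↦ ha (Nat.Coprime.coprime_mul_right h)
      rw [if_neg this, if_neg ha, zero_mul]

/-- `𝔄_n = W_n·S` is multiplicative (`S = E ∗ E⁻` with the exponential weights of `…DiagRemRademacher`). [folklore] -/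
theorem isMultiplicative_frakA (n : ℕ) (frakA : ArithmeticFunction (PowerSeries ℝ))
    (hA : ∀ k : ℕ, frakA k = PowerSeries.C (if k.Coprime n then W k else 0) *
      ∑ z ∈ k.divisorsAntidiagonal, PowerSeries.rescale (1 * Real.log z.1) (PowerSeries.exp ℝ) *
        PowerSeries.rescale (-1 * Real.log z.2) (PowerSeries.exp ℝ)) : frakA.IsMultiplicative := by
  classical
  set E : ArithmeticFunction (PowerSeries ℝ) :=
    ⟨fun d ↦ if d = 0 then 0 else PowerSeries.rescale (1 * Real.log d) (PowerSeries.exp ℝ), if_pos rfl⟩ with hEdef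
  set Em : ArithmeticFunction (PowerSeries ℝ) :=
    ⟨fun d ↦ if d = 0 then 0 else PowerSeries.rescale (-1 * Real.log d) (PowerSeries.exp ℝ), if_pos rfl⟩ with hEmdef
  have hE : ∀ d : ℕ, d ≠ 0 → E d = PowerSeries.rescale (1 * Real.log d) (PowerSeries.exp ℝ) := fun d hd ↦ by
    rw [hEdef]; exact if_neg hd
  have hEm : ∀ d : ℕ, d ≠ 0 → Em d = PowerSeries.rescale (-1 * Real.log d) (PowerSeries.exp ℝ) := fun d hd ↦ by
    rw [hEmdef]; exact if_neg hd
  set Wc : ArithmeticFunction (PowerSeries ℝ) :=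
    ⟨fun k ↦ PowerSeries.C (if k.Coprime n then W k else 0), by split_ifs <;> simp⟩ with hWcdef
  have hWc : ∀ k : ℕ, Wc k = PowerSeries.C (if k.Coprime n then W k else 0) := fun k ↦ rfl
  have hfr : frakA = Wc.pmul (E * Em) := by
    ext k : 1
    rw [pmul_apply, hA, hWc, mul_apply]
    congr 1
    refine Finset.sum_congr rfl fun z hz ↦ ?_
    obtain ⟨h1, h2⟩ := ne_zero_of_mem_divisorsAntidiagonal' hz
    rw [hE z.1 h1, hEm z.2 h2]
  rw [hfr]
  exact (isMultiplicative_Wc n Wc hWc).pmul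
    ((isMultiplicative_expWeight 1 E hE).mul (isMultiplicative_expWeight (-1) Em hEm))

/-- `H_n = AE ∗ AE⁻ ∗ 𝔄_n` is multiplicative. [folklore] -/
theorem isMultiplicative_H (n : ℕ) (AE AEm frakA : ArithmeticFunction (PowerSeries ℝ))
    (hAE : ∀ d : ℕ, AE d = PowerSeries.C ((d : ℝ)⁻¹) * PowerSeries.rescale (1 * Real.log d) (PowerSeries.exp ℝ))
    (hAEm : ∀ d : ℕ, AEm d = PowerSeries.C ((d : ℝ)⁻¹) * PowerSeries.rescale (-1 * Real.log d) (PowerSeries.exp ℝ))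
    (hA : ∀ k : ℕ, frakA k = PowerSeries.C (if k.Coprime n then W k else 0) *
      ∑ z ∈ k.divisorsAntidiagonal, PowerSeries.rescale (1 * Real.log z.1) (PowerSeries.exp ℝ) *
        PowerSeries.rescale (-1 * Real.log z.2) (PowerSeries.exp ℝ)) : (AE * AEm * frakA).IsMultiplicative :=
  ((isMultiplicative_AE 1 AE hAE).mul (isMultiplicative_AE (-1) AEm hAEm)).mul (isMultiplicative_frakA n frakA hA)

/-! ### The crude bound -/

/-- `Σ_{x ∈ dA(k)} 1 = τ(k)` and `τ(y) ≤ τ(k)` for `y ∣ k`, packaged: `Σ_{(y₁,y₂), y₁y₂=k} τ(y₁)τ(y₂) ≤ τ(k)³` as a sum of ones. [folklore] -/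
theorem sum_divisorsAntidiagonal_card_mul_card_le {k : ℕ} (hk : k ≠ 0) :
    ∑ y ∈ k.divisorsAntidiagonal, ((y.1.divisorsAntidiagonal.card : ℝ) * y.2.divisorsAntidiagonal.card) ≤
      (k.divisors.card : ℝ) ^ 3 := by
  have hcard : ∀ m : ℕ, (m.divisorsAntidiagonal.card : ℝ) = m.divisors.card := by
    intro m
    have h := Nat.sum_divisorsAntidiagonal (n := m) (fun _ _ ↦ (1 : ℝ))
    simp only [Finset.sum_const, nsmul_eq_mul, mul_one] at h
    exact h
  have hle : ∀ y ∈ k.divisorsAntidiagonal, ((y.1.divisorsAntidiagonal.card : ℝ) * y.2.divisorsAntidiagonal.card) ≤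
      (k.divisors.card : ℝ) * k.divisors.card := by
    intro y hy
    have hy' := Nat.mem_divisorsAntidiagonal.1 hy
    rw [hcard, hcard]
    have h1 : y.1.divisors.card ≤ k.divisors.card :=
      Finset.card_le_card (Nat.divisors_subset_of_dvd hk ⟨y.2, hy'.1.symm⟩)
    have h2 : y.2.divisors.card ≤ k.divisors.card :=
      Finset.card_le_card (Nat.divisors_subset_of_dvd hk ⟨y.1, by rw [mul_comm]; exact hy'.1.symm⟩)
    exact mul_le_mul (by exact_mod_cast h1) (by exact_mod_cast h2) (Nat.cast_nonneg _) (Nat.cast_nonneg _)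
  refine (Finset.sum_le_sum hle).trans ?_
  rw [Finset.sum_const, nsmul_eq_mul, hcard]
  ring_nf
  rfl

/-- **The crude bound `|η_n^{(c)}(m)| ≤ τ(m)³(log m)^c/m`** (`m ≥ 1`): every term of the triple sum has modulus `≤ (log m)^c/m`
(`|W_n(y)| ≤ 1/y`, `x₁x₂z₁z₂ = m`), and there are `≤ τ(m)³` terms. [cite: KowalskiMichelVanderKam2000, Prop. 5.1 — derivation] -/
theorem abs_eta_le_crude (n c : ℕ) {m : ℕ} (hm : m ≠ 0) :
    |∑ y ∈ m.divisorsAntidiagonal, ∑ x ∈ y.1.divisorsAntidiagonal, ∑ z ∈ y.2.divisorsAntidiagonal,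
        (x.1 : ℝ)⁻¹ * (x.2 : ℝ)⁻¹ * (if y.2.Coprime n then W y.2 else 0) *
          (Real.log x.1 - Real.log x.2 + (Real.log z.1 - Real.log z.2)) ^ c| ≤
      (m.divisors.card : ℝ) ^ 3 * Real.log m ^ c / m := by
  have hm0 : (0 : ℝ) < m := by exact_mod_cast Nat.pos_of_ne_zero hm
  have hlogm : 0 ≤ Real.log (m : ℝ) := Real.log_natCast_nonneg m
  -- termwise bound
  have hterm : ∀ y ∈ m.divisorsAntidiagonal, ∀ x ∈ y.1.divisorsAntidiagonal, ∀ z ∈ y.2.divisorsAntidiagonal,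
      |(x.1 : ℝ)⁻¹ * (x.2 : ℝ)⁻¹ * (if y.2.Coprime n then W y.2 else 0) *
          (Real.log x.1 - Real.log x.2 + (Real.log z.1 - Real.log z.2)) ^ c| ≤ Real.log m ^ c / m := by
    intro y hy x hx z hz
    have hy' := Nat.mem_divisorsAntidiagonal.1 hy
    have hx' := Nat.mem_divisorsAntidiagonal.1 hx
    have hz' := Nat.mem_divisorsAntidiagonal.1 hz
    obtain ⟨hx1, hx2⟩ := ne_zero_of_mem_divisorsAntidiagonal' hx
    obtain ⟨hz1, hz2⟩ := ne_zero_of_mem_divisorsAntidiagonal' hz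
    obtain ⟨hy1, hy2⟩ := ne_zero_of_mem_divisorsAntidiagonal' hy
    have l1 : 0 ≤ Real.log (x.1 : ℝ) := Real.log_natCast_nonneg _
    have l2 : 0 ≤ Real.log (x.2 : ℝ) := Real.log_natCast_nonneg _
    have l3 : 0 ≤ Real.log (z.1 : ℝ) := Real.log_natCast_nonneg _
    have l4 : 0 ≤ Real.log (z.2 : ℝ) := Real.log_natCast_nonneg _
    have hsum : Real.log (x.1 : ℝ) + Real.log x.2 + Real.log z.1 + Real.log z.2 = Real.log m := by
      have c1 : (x.1 : ℝ) ≠ 0 := Nat.cast_ne_zero.2 hx1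
      have c2 : (x.2 : ℝ) ≠ 0 := Nat.cast_ne_zero.2 hx2
      have c3 : (z.1 : ℝ) ≠ 0 := Nat.cast_ne_zero.2 hz1
      have c4 : (z.2 : ℝ) ≠ 0 := Nat.cast_ne_zero.2 hz2
      rw [show (m : ℝ) = ((x.1 : ℝ) * x.2) * ((z.1 : ℝ) * z.2) by
          rw [← hy'.1, ← hx'.1, ← hz'.1]; push_cast; ring,
        Real.log_mul (mul_ne_zero c1 c2) (mul_ne_zero c3 c4), Real.log_mul c1 c2, Real.log_mul c3 c4]
      ring
    have hL : |Real.log (x.1 : ℝ) - Real.log x.2 + (Real.log z.1 - Real.log z.2)| ≤ Real.log m := by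
      rw [abs_le]; constructor <;> linarith
    have hW : |(if y.2.Coprime n then W y.2 else 0)| ≤ (y.2 : ℝ)⁻¹ := by
      split_ifs
      · exact abs_W_le y.2
      · rw [abs_zero]; positivity
    have hx12 : (x.1 : ℝ)⁻¹ * (x.2 : ℝ)⁻¹ = (y.1 : ℝ)⁻¹ := by
      rw [← mul_inv, ← Nat.cast_mul, hx'.1]
    rw [abs_mul, abs_mul, abs_pow, abs_mul, abs_inv, abs_inv, Nat.abs_cast, Nat.abs_cast, hx12]
    have hy12 : (y.1 : ℝ)⁻¹ * (y.2 : ℝ)⁻¹ = (m : ℝ)⁻¹ := by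
      rw [← mul_inv, ← Nat.cast_mul, hy'.1]
    calc (y.1 : ℝ)⁻¹ * |(if y.2.Coprime n then W y.2 else 0)| *
          |Real.log (x.1 : ℝ) - Real.log x.2 + (Real.log z.1 - Real.log z.2)| ^ c
        ≤ (y.1 : ℝ)⁻¹ * (y.2 : ℝ)⁻¹ * Real.log m ^ c := by
          gcongr
      _ = Real.log m ^ c / m := by rw [hy12, inv_mul_eq_div]
  calc _ ≤ ∑ y ∈ m.divisorsAntidiagonal, ∑ x ∈ y.1.divisorsAntidiagonal, ∑ z ∈ y.2.divisorsAntidiagonal,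
        Real.log m ^ c / m := by
        refine (Finset.abs_sum_le_sum_abs _ _).trans (Finset.sum_le_sum fun y hy ↦ ?_)
        refine (Finset.abs_sum_le_sum_abs _ _).trans (Finset.sum_le_sum fun x hx ↦ ?_)
        exact (Finset.abs_sum_le_sum_abs _ _).trans (Finset.sum_le_sum fun z hz ↦ hterm y hy x hx z hz)
    _ = (∑ y ∈ m.divisorsAntidiagonal, ((y.1.divisorsAntidiagonal.card : ℝ) * y.2.divisorsAntidiagonal.card)) *
        (Real.log m ^ c / m) := by
        rw [Finset.sum_mul]
        refine Finset.sum_congr rfl fun y _ ↦ ?_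
        simp only [Finset.sum_const, nsmul_eq_mul]; ring
    _ ≤ (m.divisors.card : ℝ) ^ 3 * (Real.log m ^ c / m) :=
        mul_le_mul_of_nonneg_right (sum_divisorsAntidiagonal_card_mul_card_le hm) (by positivity)
    _ = _ := by ring

end Summit.Parity.GeneralizedHardyLittlewood.Theorems.MomentsBeyondDiagonal.DiagCorner

end
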